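import Summits.PneNP.PneNP.Theorems.SymmetryBudgetNoHiddenOrderValueOrDefs

/-!
# `NoHiddenOrder` (stmt-PneNP-14781), (R2c) value layer V: the value of a label at a SECTION node, and the value module — definitions

Route `PneNP/SymmetryBudget`.  The gate-level realisation of the section case of `CertifiedLabels.val` with the bit valuation
(`…BitValuationDefs`: `paste` = `PCol`/`PAdj` over `ltCnt`, `mult`, `Covers`) for a label `L = (U, X, λ)` whose decoded instance is `(U, col)`:

* `VAnd` reads the final analysis of `L` (membership, one-hot colours, the component wires `reach u w`, the switching tests `tw u w`) and, for
  every proper non-empty `U' ⊂ U`, the EXTERNAL wires `ptOk U'` / `ptBit U' b` of the part label `L.part U'`; it computes `isPart U'` (`U'` is a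
  switching component of `(U, col)`), `andOk` (every part label is valued), a `VecCmp` over parts, the pair-count gates of `ltCnt`
  (`cntIs U' t`), the multiplicity thresholds of `mult` (`multGe U' q`), and the pasted bits `pCol i c` / `pAdj i j` literally as in `PCol`/`PAdj`
  (row sources `rowSrc`, same-copy tests `scp`, cross bits through the colour-level switching data `swcc`);
* `Value` ties a label's final decode stage, a `VOr` and a `VAnd`: `decOK = stop ∧ ¬dead`, and the OUTPUTS `ok` (the label has a value) and
  `bit b` (bit `b` of it) — a leaf when `|U| = 1` (the colour of the single vertex), else by the section flag `isAND`.
Semantics in `…ValueAnd.lean` / `…Value.lean`.  Definitions only; supports stmt-PneNP-14781.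
-/

set_option linter.dupNamespace false -- `Summit.PneNP.PneNP.…` (D-0017 single-conjunct layout)

namespace Summit.PneNP.PneNP.Theorems

open Finset Literature.Computability.Complexity Literature.Computability.Complexity.SymProg CGBits

variable {ι Λ : Type*} [DecidableEq ι] [DecidableEq Λ] (P : SymProg ι Λ)
variable (V : Type*) [Fintype V] [DecidableEq V] (N n : ℕ) (U : Finset V)

/-- The proper non-empty subsets of `U`: the possible blocks of parts. [folklore] -/
def partSets {V : Type*} [DecidableEq V] (U : Finset V) : Finset (Finset V) := U.powerset.filter fun U' => U'.Nonempty ∧ U' ≠ U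

/-- The multiplicity threshold index of row `i` at start `t` for blocks of size `s`: `(i - t) / s + 1`, in `Fin (n + 2)`. [folklore] -/
def qIdx {n : ℕ} (i : Fin n) (t s : ℕ) : Fin (n + 2) :=
  ⟨(i - t) / s + 1, by have := Nat.div_le_self ((i : ℕ) - t) s; have := i.2; omega⟩

/-- **The value module at a section node** (see the module docstring). [folklore] -/
structure VAnd where
  /-- INPUT: block membership of the decoded instance (`= U` when decoded) -/
  mem : V → ι ⊕ Λ
  /-- INPUT: one-hot colours -/
  val : V → Fin n → ι ⊕ Λ
  /-- INPUT: `reach u w` — `w` in the switching component of `u` -/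
  reach : V → V → ι ⊕ Λ
  /-- INPUT: `tw u w` — the switching test of the cells of `u`, `w` -/
  tw : V → V → ι ⊕ Λ
  /-- EXTERNAL: the part label `L.part U'` has a value -/
  ptOk : Finset V → ι ⊕ Λ
  /-- EXTERNAL: the bits of its value -/
  ptBit : Finset V → Fin (NB n) → ι ⊕ Λ
  /-- the constant false -/
  ff : Λ
  /-- `nreach u w` -/
  nreach : V → V → Λ
  /-- `partAt u U'`: the component of `u` is exactly `U'` -/
  partAt : V → Finset V → Λ
  /-- `isPart U'`: `U'` is a part -/
  isPart : Finset V → Λ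
  /-- `nisPart U'` -/
  nisPart : Finset V → Λ
  /-- `imp U' = ¬isPart U' ∨ ptOk U'` -/
  imp : Finset V → Λ
  /-- OUTPUT `andOk`: all parts are valued -/
  andOk : Λ
  /-- comparison of part values -/
  VP : P.VecCmp (Finset V) (NB n)
  /-- `pg U' U'' u = [u ∈ U''] ∧ isPart U'' ∧ less U'' U'` (one per vertex of a smaller part) -/
  pg : Finset V → Finset V → V → Λ
  /-- `cntGe U' t`: at least `t` rows before the class of `U'` -/
  cntGe : Finset V → Fin (n + 2) → Λ
  /-- `ncntGe` -/
  ncntGe : Finset V → Fin (n + 2) → Λ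
  /-- `cntIs U' t`: exactly `t` rows before the class of `U'` -/
  cntIs : Finset V → Fin (n + 1) → Λ
  /-- `eqp U' U'' = isPart U'' ∧ eqall U'' U'` -/
  eqp : Finset V → Finset V → Λ
  /-- `multGe U' q`: at least `q` parts with the value of `U'` -/
  multGe : Finset V → Fin (n + 2) → Λ
  /-- `rowSrc i U' t`: row `i` is covered by the class of the part `U'` starting at row `t` -/
  rowSrc : Fin n → Finset V → Fin (n + 1) → Λ
  /-- `pcb i c U' t o = rowSrc i U' t ∧ ptBit U' (cIdx o c)` -/
  pcb : Fin n → Fin n → Finset V → Fin (n + 1) → Fin n → Λ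
  /-- OUTPUT colour bit `pCol i c` -/
  pCol : Fin n → Fin n → Λ
  /-- `scp i j U' t`: rows `i`, `j` lie in the same copy of the class of `U'` starting at `t` -/
  scp : Fin n → Fin n → Finset V → Fin (n + 1) → Λ
  /-- `sameCopy i j` -/
  sameCopy : Fin n → Fin n → Λ
  /-- `nsame i j` -/
  nsame : Fin n → Fin n → Λ
  /-- `pab i j U' t o o' = scp i j U' t ∧ ptBit U' (aIdx o o')` -/
  pab : Fin n → Fin n → Finset V → Fin (n + 1) → Fin n → Fin n → Λ
  /-- `pOwn i j`: adjacency inside one copy -/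
  pOwn : Fin n → Fin n → Λ
  /-- `swu c c' u w = mem u ∧ mem w ∧ val u c ∧ val w c' ∧ tw u w` -/
  swu : Fin n → Fin n → V → V → Λ
  /-- `swcc c c'`: the colour-level switching datum -/
  swcc : Fin n → Fin n → Λ
  /-- `xcp i j c c' = pCol i c ∧ pCol j c' ∧ swcc c c'` -/
  xcp : Fin n → Fin n → Fin n → Fin n → Λ
  /-- `xc i j`: cross bit of the two row colours -/
  xc : Fin n → Fin n → Λ
  /-- `pX i j = nsame i j ∧ xc i j` -/
  pX : Fin n → Fin n → Λ
  /-- OUTPUT adjacency bit `pAdj i j` -/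
  pAdj : Fin n → Fin n → Λ
  kind_ff : P.kind ff = Kind.or
  srcs_ff : P.srcs ff = ∅
  kind_nreach : ∀ u w, P.kind (nreach u w) = Kind.nor
  srcs_nreach : ∀ u w, P.srcs (nreach u w) = {reach u w}
  kind_partAt : ∀ u U', P.kind (partAt u U') = Kind.and
  srcs_partAt : ∀ u U', P.srcs (partAt u U') = U'.image (reach u) ∪ (univ \ U').image fun w => Sum.inr (nreach u w)
  kind_isPart : ∀ U', P.kind (isPart U') = Kind.or
  srcs_isPart : ∀ U', P.srcs (isPart U') = if U' ∈ partSets U then U'.image fun u => Sum.inr (partAt u U') else ∅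
  kind_nisPart : ∀ U', P.kind (nisPart U') = Kind.nor
  srcs_nisPart : ∀ U', P.srcs (nisPart U') = {Sum.inr (isPart U')}
  kind_imp : ∀ U', P.kind (imp U') = Kind.or
  srcs_imp : ∀ U', P.srcs (imp U') = {Sum.inr (nisPart U'), ptOk U'}
  kind_andOk : P.kind andOk = Kind.and
  srcs_andOk : P.srcs andOk = (partSets U).image fun U' => Sum.inr (imp U')
  VP_b : ∀ U' b, VP.b U' b = ptBit U' b
  kind_pg : ∀ U' U'' u, P.kind (pg U' U'' u) = if u ∈ U'' then Kind.and else Kind.or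
  srcs_pg : ∀ U' U'' u, P.srcs (pg U' U'' u) = if u ∈ U'' then {Sum.inr (isPart U''), Sum.inr (VP.less U'' U')} else ∅
  kind_cntGe : ∀ U' t, P.kind (cntGe U' t) = Kind.atLeast t
  srcs_cntGe : ∀ U' t, P.srcs (cntGe U' t) = (partSets U ×ˢ (univ : Finset V)).image fun Uu => Sum.inr (pg U' Uu.1 Uu.2)
  pg_injective : ∀ U', Function.Injective fun Uu : Finset V × V => pg U' Uu.1 Uu.2
  kind_ncntGe : ∀ U' t, P.kind (ncntGe U' t) = Kind.nor
  srcs_ncntGe : ∀ U' t, P.srcs (ncntGe U' t) = {Sum.inr (cntGe U' t)}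
  kind_cntIs : ∀ U' t, P.kind (cntIs U' t) = Kind.and
  srcs_cntIs : ∀ U' t, P.srcs (cntIs U' t) = {Sum.inr (cntGe U' t.castSucc), Sum.inr (ncntGe U' t.succ)}
  kind_eqp : ∀ U' U'', P.kind (eqp U' U'') = Kind.and
  srcs_eqp : ∀ U' U'', P.srcs (eqp U' U'') = {Sum.inr (isPart U''), Sum.inr (VP.eqall U'' U')}
  kind_multGe : ∀ U' q, P.kind (multGe U' q) = Kind.atLeast q
  srcs_multGe : ∀ U' q, P.srcs (multGe U' q) = (partSets U).image fun U'' => Sum.inr (eqp U' U'')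
  eqp_injective : ∀ U', Function.Injective (eqp U')
  kind_rowSrc : ∀ i U' t, P.kind (rowSrc i U' t) = if (t : ℕ) ≤ i then Kind.and else Kind.or
  srcs_rowSrc : ∀ i U' t, P.srcs (rowSrc i U' t) =
    if (t : ℕ) ≤ i then {Sum.inr (isPart U'), Sum.inr (cntIs U' t), Sum.inr (multGe U' (qIdx i t U'.card))} else ∅
  kind_pcb : ∀ i c U' t o, P.kind (pcb i c U' t o) = if (o : ℕ) = ((i : ℕ) - t) % U'.card then Kind.and else Kind.or
  srcs_pcb : ∀ i c U' t o, P.srcs (pcb i c U' t o) =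
    if (o : ℕ) = ((i : ℕ) - t) % U'.card then {Sum.inr (rowSrc i U' t), ptBit U' (cIdx o c)} else ∅
  kind_pCol : ∀ i c, P.kind (pCol i c) = Kind.or
  srcs_pCol : ∀ i c, P.srcs (pCol i c) =
    (partSets U ×ˢ ((univ : Finset (Fin (n + 1))) ×ˢ (univ : Finset (Fin n)))).image fun z => Sum.inr (pcb i c z.1 z.2.1 z.2.2)
  kind_scp : ∀ i j U' t, P.kind (scp i j U' t) =
    if (t : ℕ) ≤ i ∧ (t : ℕ) ≤ j ∧ ((i : ℕ) - t) / U'.card = ((j : ℕ) - t) / U'.card then Kind.and else Kind.or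
  srcs_scp : ∀ i j U' t, P.srcs (scp i j U' t) =
    if (t : ℕ) ≤ i ∧ (t : ℕ) ≤ j ∧ ((i : ℕ) - t) / U'.card = ((j : ℕ) - t) / U'.card then
      {Sum.inr (isPart U'), Sum.inr (cntIs U' t), Sum.inr (multGe U' (qIdx i t U'.card))} else ∅
  kind_sameCopy : ∀ i j, P.kind (sameCopy i j) = Kind.or
  srcs_sameCopy : ∀ i j, P.srcs (sameCopy i j) =
    (partSets U ×ˢ (univ : Finset (Fin (n + 1)))).image fun z => Sum.inr (scp i j z.1 z.2)
  kind_nsame : ∀ i j, P.kind (nsame i j) = Kind.nor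
  srcs_nsame : ∀ i j, P.srcs (nsame i j) = {Sum.inr (sameCopy i j)}
  kind_pab : ∀ i j U' t o o', P.kind (pab i j U' t o o') =
    if (o : ℕ) = ((i : ℕ) - t) % U'.card ∧ (o' : ℕ) = ((j : ℕ) - t) % U'.card then Kind.and else Kind.or
  srcs_pab : ∀ i j U' t o o', P.srcs (pab i j U' t o o') =
    if (o : ℕ) = ((i : ℕ) - t) % U'.card ∧ (o' : ℕ) = ((j : ℕ) - t) % U'.card then {Sum.inr (scp i j U' t), ptBit U' (aIdx o o')} else ∅
  kind_pOwn : ∀ i j, P.kind (pOwn i j) = Kind.or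
  srcs_pOwn : ∀ i j, P.srcs (pOwn i j) =
    (partSets U ×ˢ ((univ : Finset (Fin (n + 1))) ×ˢ ((univ : Finset (Fin n)) ×ˢ (univ : Finset (Fin n))))).image
      fun z => Sum.inr (pab i j z.1 z.2.1 z.2.2.1 z.2.2.2)
  kind_swu : ∀ c c' u w, P.kind (swu c c' u w) = Kind.and
  srcs_swu : ∀ c c' u w, P.srcs (swu c c' u w) = {mem u, mem w, val u c, val w c', tw u w}
  kind_swcc : ∀ c c', P.kind (swcc c c') = Kind.or
  srcs_swcc : ∀ c c', P.srcs (swcc c c') = (univ : Finset (V × V)).image fun uw => Sum.inr (swu c c' uw.1 uw.2)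
  kind_xcp : ∀ i j c c', P.kind (xcp i j c c') = Kind.and
  srcs_xcp : ∀ i j c c', P.srcs (xcp i j c c') = {Sum.inr (pCol i c), Sum.inr (pCol j c'), Sum.inr (swcc c c')}
  kind_xc : ∀ i j, P.kind (xc i j) = Kind.or
  srcs_xc : ∀ i j, P.srcs (xc i j) = (univ : Finset (Fin n × Fin n)).image fun cc => Sum.inr (xcp i j cc.1 cc.2)
  kind_pX : ∀ i j, P.kind (pX i j) = Kind.and
  srcs_pX : ∀ i j, P.srcs (pX i j) = {Sum.inr (nsame i j), Sum.inr (xc i j)}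
  kind_pAdj : ∀ i j, P.kind (pAdj i j) = Kind.or
  srcs_pAdj : ∀ i j, P.srcs (pAdj i j) = {Sum.inr (pOwn i j), Sum.inr (pX i j)}

namespace VAnd

variable {P V n U} (A : VAnd P V n U)

/-- The pasted value WIRE of bit `b`. [folklore] -/
def aw (b : Fin (NB n)) : ι ⊕ Λ :=
  match bdec b with
  | .inl (i, c) => Sum.inr (A.pCol i c)
  | .inr (i, j) => Sum.inr (A.pAdj i j)

end VAnd

variable (T F : ℕ) (X : Finset V) (lam : V → ℕ) (adm : CertifiedLabels.Label V → Prop) [DecidablePred adm]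

/-- **The value module of a label**: its decode module, the two branch modules, and the output gates (see the module docstring).
[folklore] -/
structure Value where
  /-- the decode module of the label -/
  Dc : Decode P V N T n U X lam F
  /-- the individualisation branch -/
  VO : VOr P V N T n U X lam adm
  /-- the section branch -/
  VA : VAnd P V n U
  /-- the constant false -/
  ff : Λ
  /-- `ndead = ¬ dead` at the last stage -/
  ndead : Λ
  /-- `decOK = stop ∧ ndead`: the label decodes -/
  decOK : Λ
  /-- `a1 = isAND ∧ andOk` -/
  a1 : Λ
  /-- `a2 = nisAND ∧ orOk` -/
  a2 : Λ
  /-- `okk = a1 ∨ a2` -/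
  okk : Λ
  /-- OUTPUT `ok`: the label has a value -/
  ok : Λ
  /-- `b1 b = isAND ∧ andOk ∧ aw b` -/
  b1 : Fin (NB n) → Λ
  /-- `b2 b = nisAND ∧ orBit b` -/
  b2 : Fin (NB n) → Λ
  /-- `bb b = b1 b ∨ b2 b` -/
  bb : Fin (NB n) → Λ
  /-- OUTPUT `bit b`: bit `b` of the value -/
  bit : Fin (NB n) → Λ
  -- the branch modules read the last decode stage
  VO_mem : VO.mem = Dc.memS (Fin.last F)
  VO_val : VO.val = Dc.valS (Fin.last F)
  VO_lt : ∀ u v, VO.lt u v = Sum.inr ((Dc.An (Fin.last F)).O.lt u v)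
  VO_eq : ∀ u v, VO.eq u v = Sum.inr ((Dc.An (Fin.last F)).O.eq u v)
  VO_sel : ∀ u, VO.sel u = Sum.inr ((Dc.An (Fin.last F)).M.sel u)
  VO_adj : VO.adj = Dc.adj
  VA_mem : VA.mem = Dc.memS (Fin.last F)
  VA_val : VA.val = Dc.valS (Fin.last F)
  VA_reach : ∀ u w, VA.reach u w = Sum.inr ((Dc.An (Fin.last F)).C.R.r (Fin.last T) u w)
  VA_tw : ∀ u w, VA.tw u w = Sum.inr ((Dc.An (Fin.last F)).C.S.twice u w).tw
  kind_ff : P.kind ff = Kind.or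
  srcs_ff : P.srcs ff = ∅
  kind_ndead : P.kind ndead = Kind.nor
  srcs_ndead : P.srcs ndead = {Dc.deadS (Fin.last F)}
  kind_decOK : P.kind decOK = Kind.and
  srcs_decOK : P.srcs decOK = {Sum.inr (Dc.An (Fin.last F)).stop, Sum.inr ndead}
  kind_a1 : P.kind a1 = Kind.and
  srcs_a1 : P.srcs a1 = {Sum.inr (Dc.An (Fin.last F)).isAND, Sum.inr VA.andOk}
  kind_a2 : P.kind a2 = Kind.and
  srcs_a2 : P.srcs a2 = {Sum.inr (Dc.An (Fin.last F)).nisAND, Sum.inr VO.orOk}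
  kind_okk : P.kind okk = Kind.or
  srcs_okk : P.srcs okk = {Sum.inr a1, Sum.inr a2}
  kind_ok : P.kind ok = Kind.and
  srcs_ok : P.srcs ok = if U.card = 1 then {Sum.inr decOK} else {Sum.inr decOK, Sum.inr okk}
  kind_b1 : ∀ b, P.kind (b1 b) = Kind.and
  srcs_b1 : ∀ b, P.srcs (b1 b) = {Sum.inr (Dc.An (Fin.last F)).isAND, Sum.inr VA.andOk, VA.aw b}
  kind_b2 : ∀ b, P.kind (b2 b) = Kind.and
  srcs_b2 : ∀ b, P.srcs (b2 b) = {Sum.inr (Dc.An (Fin.last F)).nisAND, Sum.inr (VO.orBit b)}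
  kind_bb : ∀ b, P.kind (bb b) = Kind.or
  srcs_bb : ∀ b, P.srcs (bb b) = {Sum.inr (b1 b), Sum.inr (b2 b)}
  kind_bit : ∀ b, P.kind (bit b) = Kind.and
  srcs_bit : ∀ b, P.srcs (bit b) =
    if U.card = 1 then
      insert (Sum.inr decOK)
        (match bdec b with
          | .inl (i, c) => if (i : ℕ) = 0 then U.image fun u => Dc.valS (Fin.last F) u c else {Sum.inr ff}
          | .inr _ => {Sum.inr ff})
    else {Sum.inr decOK, Sum.inr (bb b)}

end Summit.PneNP.PneNP.Theorems
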